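import Summits.BirchSwinnertonDyer.Rank1Residual.X1.GeneratorCountTorsionRat
import Summits.BirchSwinnertonDyer.Rank1Residual.Additive.CongruentPartnerBudgetSchemaHolds
import Summits.BirchSwinnertonDyer.Rank1Residual.X2.IsogenyLambdaInvariant
import Summits.BirchSwinnertonDyer.BirchSwinnertonDyer.Theorems.Rank1ResidualX1Isogeny
import HarnessLib

/-!
# Route M's generator count ALSO bounds `λ` at a `μ = 0` member: `p^B ≤ #(X/𝔪X) ≤ #(X/pX) = p^λ`
# (cell `b2b-bsdres`, unit `b2b-bsdres-eisenstein-p1`, gen 17; X1R0-GAPMAP §26, variant V82′)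

HONEST FRAMING (run/shared/lean/b2b/bsd-rank1-residual/, verbatim in every file): the goal of the
cell is to DELETE the COMBINATION-SHAPED residual classes of the Birch–Swinnerton-Dyer formula for
ALL analytic-rank `≤ 1` elliptic curves over `ℚ` — "full BSD formula for every rank `≤ 1` curve in
class `C`" assembled STRICTLY from published theorems — so that the rank-`≤ 1` remainder becomes
exactly the CONSTRUCTION-SHAPED classes, which are TYPED (missing-input `Prop`s), NOT attempted.
This is not "finishing BSD". Sub-cell `b2b-bsdres-eisenstein-p1` (CLASS-OWNERS row "X1 (r = 0)"):
research route; NO CLAIM BEYOND STATED CLASSES; nothing here changes a label; nothing is booked.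
THEOREMS ONLY — no definition, no named fact, no typed input introduced, nothing about any
particular curve asserted.

## What and why

The kernel form of route M (`X1/GeneratorCountSqueeze.lean`) turns a generator COUNT
`GeneratorCountGE W p B` ("`p^B ≤ #(X/𝔪X)`", supplied on the leaf by the Tamagawa / anomalous /
torsion count files `X1/GeneratorCount*.lean`) and LEMMA M₀ (`X1/GeneratorBound.lean`,
`#(X/𝔪X) ≤ p^{v_p(f_E(0))}`) into the membership certificate `λ_alg ∈ {d | ∃ v ≥ B, (d, v) ∈ S}`.
The census of record (X1R0-GAPMAP §25.7) still needed, for 30 classes, a TYPED lower bound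
`AlgebraicLambdaGE` taken from route T at a layer `m ≥ 1` or from route D. This file records that
at a member with `μ_an = 0` the SAME count bounds `λ` itself, inside the kernel:

* §1 `natCard_quotient_smul_top_le_pow_lambdaInvariant`: for a finitely generated torsion
  `Λ`-module `X` with `μ(X) = 0` and no nonzero finite submodule and ANY ideal `I ⊇ (p)`,
  **`#(X/IX) ≤ p^{λ(X)}`** — `X/IX` is a quotient of `X/pX`, whose order is `p^λ` by the tree
  theorem `Additive.card_quotient_eq_pow_lambdaInvariant_holds` (n1011 / cc-typer-2: `μ = 0` and no
  finite submodule make `X` free of rank `λ` over `ℤ_p`, Washington §13.2); in particular for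
  `I = 𝔪 = (p, T)` (`natCard_quotient_maximalIdeal_le_pow_lambdaInvariant`) and, later, for the
  layer ideals `(p, ω_m)`.
* §2 `AlgebraicLambdaMem.of_generatorCount_of_muZero`: at a good ordinary Eisenstein pair with
  `μ_an = 0` (`AnalyticMuLE W p 0`, hence `μ(X) = 0` by Kato–Wuthrich, `MuPart.mu_eq_zero_of_analyticMuLE_zero`)
  and no finite submodule, **`GeneratorCountGE W p B ⇒ AlgebraicLambdaMem W p {d | B ≤ d}`**; with
  the Newton certificate, `λ_alg ∈ {d | ∃ v, (d, v) ∈ S ∧ B ≤ v ∧ B ≤ d}`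
  (`AlgebraicLambdaMem.of_generatorCount_of_muZero_newton`).
* §3 the certificate may be read at an ISOGENOUS leaf curve: `RankZero.Leaf.of_isIsogenous` and
  `AlgebraicLambdaMem.of_isIsogenous` (`λ` is an isogeny invariant — eisenstein-p2's KERNEL theorem
  `X2.IsogenyLambdaInvariant.lambdaInvariant_eq_of_isIsogenous`; torsion of `X(E'/ℚ_∞)` by
  Kato–Wuthrich at the leaf pair `(E', p)`).
* §4 the leaf ENDS with the sharper gap check `∀ (d,v) ∈ S, B ≤ v → B ≤ d → Even d → d ≤ n → n ≤ d+1`: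
  generic (`Leaf.bsdp_of_muZero_of_generatorCount_lambda{,_of_prop415,_of_prop414,_inter_of_prop415}`),
  from RATIONAL torsion data at `δ = 1` (`Leaf.bsdp_of_muZero_of_tamagawaCount_rationalTorsion_lambda`)
  and from a certified `ℚ_p`-point of order `p` at `δ = 0`
  (`Leaf.bsdp_of_muZero_of_tamagawaCountAtP_two_lambda`).

CENSUS (EVIDENCE, outside the kernel; `work/v82/v82.py` of the gen-17 seat): of the 30 `TAM+LB`
route-M₀ closures of record, 16 are kernel-shaped through the route-D bound already, and §2 makes 8
more kernel-shaped at layer 0 (`158690a 265370u 330650p 385970k 447356b @3` at their `δ = 1` member,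
`B = 3`; `221390j 296450gj 296450jl @3` at their `μ = 0` member with a certified `ℚ_3`-point of
order 3, `B = 3`), e.g. `158690a1@3`: `λ_an = 6`, atoms `Q₂` (slope `3/2`, `v_3(Q₂(0)) = 3`) and
`Q₄` (slope `1/4`): M₀ kills `Q₄` alone (`1 < 3`), §2 kills `Q₂` alone (`deg 2 < 3`), parity the odd
degrees — `λ_alg = 6`. Nothing is booked by this file.

References: [GreenbergLNM1716] §1 p. 60, Prop. 3.10, Thm. 4.1, §4 Lemma 4.2, Prop. 4.14/4.15,
p. 137; [Washington1997] §13.2 (after Thm. 13.12); [Wuthrich2014] Thm. 16; [GreenbergVatsal2000] §2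
p. 28 (λ is an isogeny invariant); X1R0-GAPMAP §14.1, §21–§26.
-/

noncomputable section

open scoped Classical

open Function Field NumberField IsDedekindDomain WeierstrassCurve
  Literature.NumberTheory.EllipticCurves Literature.NumberTheory.GaloisRepresentations
  Literature.NumberTheory.GaloisCohomology Summit.BirchSwinnertonDyer.Rank1Residual.GaloisImage
  Literature.NumberTheory.EllipticCurves.IwasawaAlgebra IsLocalRing
  Literature.NumberTheory.EllipticCurves.ModularForms
  Literature.NumberTheory.EllipticCurves.Rank1Residual
  Literature.NumberTheory.EllipticCurves.Greenberg1999
  Summit.BirchSwinnertonDyer.BirchSwinnertonDyer.Theorems.Rank1ResidualX1Defs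
  Summit.BirchSwinnertonDyer.Rank1Residual.X1.MuLambda
  Summit.BirchSwinnertonDyer.Rank1Residual.X1.MuPart
  Summit.BirchSwinnertonDyer.Rank1Residual.X1.ParitySqueeze
  Summit.BirchSwinnertonDyer.Rank1Residual.X1.TamagawaSqueeze
  Summit.BirchSwinnertonDyer.Rank1Residual.X1.FactorSqueeze
  Summit.BirchSwinnertonDyer.Rank1Residual.X1.GeneratorSqueeze
  Summit.BirchSwinnertonDyer.Rank1Residual.X1.GeneratorCountAnomalous
  Summit.BirchSwinnertonDyer.Rank1Residual.X1.GeneratorCountAnomalousTwo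
  Summit.BirchSwinnertonDyer.Rank1Residual.X1.GeneratorCountSqueeze
  Summit.BirchSwinnertonDyer.Rank1Residual.X1.GeneratorCountSqueezeFacts
  Summit.BirchSwinnertonDyer.Rank1Residual.X1.GeneratorCountAnomalousLeaf
  Summit.BirchSwinnertonDyer.Rank1Residual.X1.GeneratorCountTorsion
  Summit.BirchSwinnertonDyer.Rank1Residual.Additive
open Literature.NumberTheory.GaloisRepresentations.DiscreteGaloisModule (unramifiedSubgroup)

set_option autoImplicit false

namespace Summit.BirchSwinnertonDyer.Rank1Residual.X1.GeneratorCountLambda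

/-! ## §1. `#(X/IX) ≤ p^λ` for every ideal `I ∋ p` when `μ = 0` and `X` has no finite submodule -/

section Algebra

variable {p : ℕ} [hp : Fact p.Prime]

/-- **`#(X/IX) ≤ p^{λ(X)}` for every ideal `I ⊇ (p)`**, for a finitely generated torsion
`Λ = ℤ_p⟦T⟧`-module `X` with `μ(X) = 0` and no nonzero finite `Λ`-submodule: `X/IX` is a quotient
of `X/pX` and `#(X/pX) = p^{λ(X)}` (`Additive.card_quotient_eq_pow_lambdaInvariant_holds`: such an
`X` is `ℤ_p`-free of rank `λ`). [cite: Washington1997, §13.2 (after Thm. 13.12)] -/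
theorem natCard_quotient_smul_top_le_pow_lambdaInvariant (M : Type*) [AddCommGroup M]
    [Module (IwasawaAlgebra p) M] [Module.Finite (IwasawaAlgebra p) M]
    (hT : Module.IsTorsion (IwasawaAlgebra p) M) (hμ : muInvariant p M = 0)
    (hnf : ∀ N : Submodule (IwasawaAlgebra p) M, Finite N → N = ⊥)
    {I : Ideal (IwasawaAlgebra p)} (hI : augIdealP p ≤ I) :
    Nat.card (M ⧸ I • (⊤ : Submodule (IwasawaAlgebra p) M)) ≤ p ^ lambdaInvariant p M := by
  have hcard : Nat.card (M ⧸ augIdealP p • (⊤ : Submodule (IwasawaAlgebra p) M)) =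
      p ^ lambdaInvariant p M :=
    Additive.card_quotient_eq_pow_lambdaInvariant_holds p M hT hμ hnf
  haveI : Finite (M ⧸ augIdealP p • (⊤ : Submodule (IwasawaAlgebra p) M)) :=
    Nat.finite_of_card_ne_zero (by rw [hcard]; exact pow_ne_zero _ hp.out.ne_zero)
  have hle : augIdealP p • (⊤ : Submodule (IwasawaAlgebra p) M) ≤
      I • (⊤ : Submodule (IwasawaAlgebra p) M) := Submodule.smul_mono_left hI
  calc Nat.card (M ⧸ I • (⊤ : Submodule (IwasawaAlgebra p) M))
      ≤ Nat.card (M ⧸ augIdealP p • (⊤ : Submodule (IwasawaAlgebra p) M)) :=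
        Nat.card_le_card_of_surjective (Submodule.factor hle) (Submodule.factor_surjective hle)
    _ = p ^ lambdaInvariant p M := hcard

/-- **`#(X/𝔪X) ≤ p^{λ(X)}`** (`𝔪 = (p, T)` the maximal ideal of `Λ`) for a finitely generated
torsion `Λ`-module `X` with `μ(X) = 0` and no nonzero finite `Λ`-submodule: `X` needs at most `λ`
generators (`X ≅ ℤ_p^λ` as a `ℤ_p`-module). [cite: Washington1997, §13.2 (after Thm. 13.12)] -/
theorem natCard_quotient_maximalIdeal_le_pow_lambdaInvariant (M : Type*) [AddCommGroup M]
    [Module (IwasawaAlgebra p) M] [Module.Finite (IwasawaAlgebra p) M]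
    (hT : Module.IsTorsion (IwasawaAlgebra p) M) (hμ : muInvariant p M = 0)
    (hnf : ∀ N : Submodule (IwasawaAlgebra p) M, Finite N → N = ⊥) :
    Nat.card (M ⧸ maximalIdeal (IwasawaAlgebra p) • (⊤ : Submodule (IwasawaAlgebra p) M)) ≤
      p ^ lambdaInvariant p M :=
  have hprime : (augIdealP p).IsPrime := isPrime_augIdealP_holds p
  natCard_quotient_smul_top_le_pow_lambdaInvariant M hT hμ hnf
    (IsLocalRing.le_maximalIdeal hprime.ne_top)

end Algebra

/-! ## §2. At a `μ_an = 0` member the count bounds `λ`: `GeneratorCountGE W p B ⇒ λ_alg ≥ B` -/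

section Membership

variable {W : WeierstrassCurve ℚ} [W.IsElliptic] [W.IsGloballyMinimal] {p : ℕ} [hp : Fact p.Prime]

/-- **`λ_alg ≥ B` from the generator count at a `μ = 0` member.** `W/ℚ` globally minimal elliptic,
`p ≠ 2` good ordinary with `E[p]` reducible; granted Wuthrich 2014 Thm. 16 (`hW16`) and modularity
(`hmod`), both PUBLISHED: if `μ_an = 0` (`AnalyticMuLE W p 0`, typed certificate; then `μ(X) = 0`
by Kato's divisibility), `X(E/ℚ_∞)` has no nonzero finite submodule (`NoFiniteSubmoduleAt p W`,
Greenberg Prop. 4.14 / 4.15 by name) and needs at least `B` generators (`GeneratorCountGE W p B`),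
then `AlgebraicLambdaMem W p {d | B ≤ d}`: `p^B ≤ #(X/𝔪X) ≤ p^{λ(X)}` (§1).
[cite: GreenbergLNM1716, p. 137 and Prop. 4.14] [cite: Washington1997, §13.2]
[cite: Wuthrich2014, Thm. 16 (p. 397)] -/
theorem AlgebraicLambdaMem.of_generatorCount_of_muZero
    (hW16 : Wuthrich2014.charIdeal_dvd_padicLFunction) (hmod : nonempty_modularParametrizationData)
    (hp2 : p ≠ 2) (hgood : W.HasGoodReductionAtPrime p) (hord : ¬ (p : ℤ) ∣ W.frobeniusTrace p)
    (hred : ¬ W.HasIrreducibleModPGaloisRep p) (hμ0 : AnalyticMuLE W p 0)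
    (hnf : NoFiniteSubmoduleAt p W) {B : ℕ} (hB : GeneratorCountGE W p B) :
    AlgebraicLambdaMem W p {d | B ≤ d} := by
  intro κ γ hκ hγ hγ' D _ hXt
  have hμ : D.mu = 0 := mu_eq_zero_of_analyticMuLE_zero hW16 hmod hp2 hgood hord hred hμ0 hκ hγ hγ' D
  have hXtors : Module.IsTorsion (IwasawaAlgebra p) D.X := hXt
  have hle := natCard_quotient_maximalIdeal_le_pow_lambdaInvariant D.X hXtors hμ
    (hnf hκ hγ hγ' D hXt)
  exact (Nat.pow_le_pow_iff_right (Nat.Prime.one_lt hp.out)).mp ((hB κ γ hκ hγ hγ' D hXt).trans hle)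

/-- **The count certificate with BOTH weights: `λ_alg ∈ {d | ∃ v, (d, v) ∈ S ∧ B ≤ v ∧ B ≤ d}`** at
a `μ_an = 0` member — LEMMA M₀ (`GeneratorCountSqueeze.AlgebraicLambdaMem.of_generatorCount`:
`B ≤ v_p(f_E(0))`) intersected with §2 (`B ≤ λ(f_E)`), `L(E,1) ≠ 0` for the constant term.
[cite: GreenbergLNM1716, §4 Lemma 4.2, p. 137] [cite: Washington1997, §13.2]
[cite: Wuthrich2014, Thm. 16 (p. 397)] -/
theorem AlgebraicLambdaMem.of_generatorCount_of_muZero_newton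
    (hW16 : Wuthrich2014.charIdeal_dvd_padicLFunction) (hmod : nonempty_modularParametrizationData)
    (hp2 : p ≠ 2) (hgood : W.HasGoodReductionAtPrime p) (hord : ¬ (p : ℤ) ∣ W.frobeniusTrace p)
    (hred : ¬ W.HasIrreducibleModPGaloisRep p) (hL : W.entireLFunction 1 ≠ 0)
    (hμ0 : AnalyticMuLE W p 0) (hnf : NoFiniteSubmoduleAt p W) {B : ℕ} {S : Set (ℕ × ℕ)}
    (hB : GeneratorCountGE W p B) (hS : AnalyticLamConstValDivisorSet W p S) :
    AlgebraicLambdaMem W p {d | ∃ v, (d, v) ∈ S ∧ B ≤ v ∧ B ≤ d} := by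
  refine AlgebraicLambdaMem.mono ?_
    ((GeneratorCountSqueeze.AlgebraicLambdaMem.of_generatorCount hW16 hmod hp2 hgood hord hred hL hnf
      hB hS).inter
    (AlgebraicLambdaMem.of_generatorCount_of_muZero hW16 hmod hp2 hgood hord hred hμ0 hnf hB))
  rintro d ⟨⟨v, hv, hBv⟩, hBd⟩
  exact ⟨v, hv, hBv, hBd⟩

end Membership

/-! ## §3. Reading the certificate at an isogenous leaf curve -/

section Isogeny

open Summit.BirchSwinnertonDyer.Rank1Residual.X2.IsogenyLambdaInvariant

variable {W : WeierstrassCurve ℚ} [W.IsElliptic] [W.IsGloballyMinimal] {p : ℕ} [hp : Fact p.Prime]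
  {W' : WeierstrassCurve ℚ} [W'.IsElliptic] [W'.IsGloballyMinimal]

/-- **An isogenous globally minimal curve of a rank-zero leaf pair is a rank-zero leaf pair**
(X1-membership `ClassX1.of_isIsogenous`, analytic rank by equality of `L`-functions).
[cite: SilvermanAEC2009, Cor. VII.7.2] [cite: Knapp1993, Thm. 11.67] -/
theorem _root_.Summit.BirchSwinnertonDyer.Rank1Residual.X1.RankZero.Leaf.of_isIsogenous
    (hL : RankZero.Leaf W p) (hiso : IsIsogenous W W') : RankZero.Leaf W' p :=
  ⟨ClassX1.of_isIsogenous hiso hL.1, (analyticRank_eq_of_isIsogenous' hiso).symm.trans hL.2⟩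

/-- **A membership certificate read at an isogenous leaf curve is a certificate for the curve**:
`AlgebraicLambdaMem W' p A ⇒ AlgebraicLambdaMem W p A` for `W ∼ W'` on the rank-zero leaf — the
`λ`-invariant of `X(E/ℚ_∞)` is an isogeny invariant (KERNEL theorem
`X2.IsogenyLambdaInvariant.lambdaInvariant_eq_of_isIsogenous`, Greenberg–Vatsal p. 28) and
`X(E'/ℚ_∞)` is torsion by Kato–Wuthrich at the leaf pair `(E', p)` (`hW16`, `hmod` PUBLISHED).
This is how route M intersects constraints certified at DIFFERENT members of a class (census
kernel split `M0:multi`). [cite: GreenbergVatsal2000, §2 p. 28] [cite: Wuthrich2014, Thm. 16 (p. 397)] -/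
theorem AlgebraicLambdaMem.of_isIsogenous
    (hW16 : Wuthrich2014.charIdeal_dvd_padicLFunction) (hmod : nonempty_modularParametrizationData)
    (hL : RankZero.Leaf W p) (hiso : IsIsogenous W W') {A : Set ℕ}
    (hA : AlgebraicLambdaMem W' p A) : AlgebraicLambdaMem W p A := by
  intro κ γ hκ hγ hγ' D _ hXt
  have hX' := isClassX1_of_classX1 (hL.of_isIsogenous hiso).classX1
  haveI : NeZero (W'.conductorNorm ℤ) := ⟨(W'.conductorNorm_pos_holds).ne'⟩
  obtain ⟨D'⟩ := W'.nonempty_selmerDualData_holds κ γ hγ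
  haveI : Module.Finite (IwasawaAlgebra p) D'.X := D'.module_finite_holds hγ
  obtain ⟨hXt', -⟩ := isTorsion_and_exists_factorisation hW16 hmod hX'.two_ne
    hX'.hasGoodReductionAtPrime hX'.not_dvd_frobeniusTrace hX'.not_hasIrreducibleModPGaloisRep
    hκ hγ hγ' D'
  rw [lambdaInvariant_eq_of_isIsogenous hiso D D']
  exact hA κ γ hκ hγ hγ' D' hXt'

end Isogeny

/-! ## §4. The leaf ends with the sharper gap check `B ≤ v ∧ B ≤ d` -/

section Leaf

variable {W : WeierstrassCurve ℚ} [W.IsElliptic] [W.IsGloballyMinimal] {p : ℕ} [hp : Fact p.Prime]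

/-- **ROUTE M at a `μ = 0` member with BOTH weights: `μ_an = 0 ∧ λ_an = n ∧ (count B) ∧
(Newton data S) ∧ gap ⇒ BSD(E,p)`** on the leaf X1 ∩ {r = 0}, gap check
`∀ (d,v) ∈ S, B ≤ v → B ≤ d → Even d → d ≤ n → n ≤ d + 1` (`NoFiniteSubmoduleAt` typed here).
EXAMPLE `158690a1@3`: `n = 6`, `B = 3`, `S = {(0,0),(2,3),(4,1),(6,4)}` — `(2,3)` passes `B ≤ v` but
not `B ≤ d`. Facts `hW16`, `hGr`, `h310`, `hmod`, `hGZK` PUBLISHED.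
[cite: GreenbergLNM1716, Prop. 3.10, Thm. 4.1, §4 Lemma 4.2, p. 137] [cite: Washington1997, §13.2]
[cite: Wuthrich2014, Thm. 16 (p. 397)] -/
theorem Leaf.bsdp_of_muZero_of_generatorCount_lambda
    (hW16 : Wuthrich2014.charIdeal_dvd_padicLFunction) (hGr : greenberg_charValue_rankZero)
    (h310 : prop310_selmerCorank_mod_two_eq_lambdaInvariant)
    (hmod : nonempty_modularParametrizationData)
    (hGZK : rank_eq_analyticRank_of_analyticRank_le_one) (hL : RankZero.Leaf W p)
    (hnf : NoFiniteSubmoduleAt p W) (hμ0 : AnalyticMuLE W p 0) {n B : ℕ} {S : Set (ℕ × ℕ)}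
    (hlam : AnalyticLambdaEq W p n) (hB : GeneratorCountGE W p B)
    (hS : AnalyticLamConstValDivisorSet W p S)
    (hgap : ∀ d v, (d, v) ∈ S → B ≤ v → B ≤ d → Even d → d ≤ n → n ≤ d + 1) : BSDp W p :=
  have hX := isClassX1_of_classX1 hL.classX1
  GeneratorSqueeze.Leaf.bsdp_of_muZero_of_lambdaMem hW16 hGr h310 hmod hGZK hL hμ0 hlam
    (AlgebraicLambdaMem.of_generatorCount_of_muZero_newton hW16 hmod hX.two_ne
      hX.hasGoodReductionAtPrime hX.not_dvd_frobeniusTrace hX.not_hasIrreducibleModPGaloisRep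
      (entireLFunction_one_ne_zero_of_analyticRank_eq_zero hmod W hL.analyticRank_eq_zero) hμ0 hnf
      hB hS)
    fun d ⟨v, hv, hBv, hBd⟩ ↦ hgap d v hv hBv hBd

/-- **The same with `NoFiniteSubmoduleAt` BY NAME from Greenberg 1999 Prop. 4.15 (ii)** (good
ordinary `p ≥ 3` over `ℚ`, no hypothesis on `E(ℚ)_tors`; the leaf supplies `p ≥ 3` and good ordinary
reduction). [cite: GreenbergLNM1716, Prop. 3.10, Thm. 4.1, Prop. 4.15 (ii), p. 137]
[cite: Washington1997, §13.2] [cite: Wuthrich2014, Thm. 16 (p. 397)] -/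
theorem Leaf.bsdp_of_muZero_of_generatorCount_lambda_of_prop415
    (hW16 : Wuthrich2014.charIdeal_dvd_padicLFunction) (hGr : greenberg_charValue_rankZero)
    (h310 : prop310_selmerCorank_mod_two_eq_lambdaInvariant)
    (h415 : prop415ii_noFiniteSubmodule_of_ordinary_or_multiplicative)
    (hmod : nonempty_modularParametrizationData)
    (hGZK : rank_eq_analyticRank_of_analyticRank_le_one) (hL : RankZero.Leaf W p)
    (hμ0 : AnalyticMuLE W p 0) {n B : ℕ} {S : Set (ℕ × ℕ)}
    (hlam : AnalyticLambdaEq W p n) (hB : GeneratorCountGE W p B)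
    (hS : AnalyticLamConstValDivisorSet W p S)
    (hgap : ∀ d v, (d, v) ∈ S → B ≤ v → B ≤ d → Even d → d ≤ n → n ≤ d + 1) : BSDp W p :=
  have hX := isClassX1_of_classX1 hL.classX1
  Leaf.bsdp_of_muZero_of_generatorCount_lambda hW16 hGr h310 hmod hGZK hL
    (noFiniteSubmoduleAt_of_prop415ii h415 (lt_of_le_of_ne (Nat.Prime.two_le hp.out)
      (Ne.symm hX.two_ne)) hX.hasGoodReductionAtPrime hX.not_dvd_frobeniusTrace) hμ0 hlam hB hS hgap

/-- **The same with `NoFiniteSubmoduleAt` BY NAME from Greenberg 1999 Prop. 4.14** on members with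
`p ∤ #E(ℚ)_tors` (= Hachimori–Matsuno 2000 Cor. (i); n1011's `Additive.noFiniteSubmoduleAt_of_prop414`).
[cite: GreenbergLNM1716, Prop. 3.10, Thm. 4.1, Prop. 4.14, p. 137] [cite: HachimoriMatsuno2000, Corollary (i)]
[cite: Wuthrich2014, Thm. 16 (p. 397)] -/
theorem Leaf.bsdp_of_muZero_of_generatorCount_lambda_of_prop414
    (hW16 : Wuthrich2014.charIdeal_dvd_padicLFunction) (hGr : greenberg_charValue_rankZero)
    (h310 : prop310_selmerCorank_mod_two_eq_lambdaInvariant)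
    (h414 : prop414_noFiniteSubmodule_of_not_dvd_torsionOrder)
    (hmod : nonempty_modularParametrizationData)
    (hGZK : rank_eq_analyticRank_of_analyticRank_le_one) (hL : RankZero.Leaf W p)
    (htors : ¬ p ∣ W.torsionOrder) (hμ0 : AnalyticMuLE W p 0) {n B : ℕ} {S : Set (ℕ × ℕ)}
    (hlam : AnalyticLambdaEq W p n) (hB : GeneratorCountGE W p B)
    (hS : AnalyticLamConstValDivisorSet W p S)
    (hgap : ∀ d v, (d, v) ∈ S → B ≤ v → B ≤ d → Even d → d ≤ n → n ≤ d + 1) : BSDp W p :=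
  Leaf.bsdp_of_muZero_of_generatorCount_lambda hW16 hGr h310 hmod hGZK hL
    (noFiniteSubmoduleAt_of_prop414 h414 htors) hμ0 hlam hB hS hgap

/-- **Intersected form, all inputs named** (M₀ ∧ λ-bound ∧ a further certificate `A'`, e.g. route
C's cyclotomic factor, route D's descent bound, or a certificate read at an isogenous member via
`AlgebraicLambdaMem.of_isIsogenous`). [cite: GreenbergLNM1716, Prop. 3.10, Thm. 4.1, Prop. 4.15 (ii), pp. 132, 137]
[cite: Washington1997, §13.2] [cite: Wuthrich2014, Thm. 16 (p. 397)] -/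
theorem Leaf.bsdp_of_muZero_of_generatorCount_lambda_inter_of_prop415
    (hW16 : Wuthrich2014.charIdeal_dvd_padicLFunction) (hGr : greenberg_charValue_rankZero)
    (h310 : prop310_selmerCorank_mod_two_eq_lambdaInvariant)
    (h415 : prop415ii_noFiniteSubmodule_of_ordinary_or_multiplicative)
    (hmod : nonempty_modularParametrizationData)
    (hGZK : rank_eq_analyticRank_of_analyticRank_le_one) (hL : RankZero.Leaf W p)
    (hμ0 : AnalyticMuLE W p 0) {n B : ℕ} {S : Set (ℕ × ℕ)} {A' : Set ℕ}
    (hlam : AnalyticLambdaEq W p n) (hB : GeneratorCountGE W p B)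
    (hS : AnalyticLamConstValDivisorSet W p S) (hA' : AlgebraicLambdaMem W p A')
    (hgap : ∀ d v, (d, v) ∈ S → B ≤ v → B ≤ d → d ∈ A' → Even d → d ≤ n → n ≤ d + 1) :
    BSDp W p :=
  have hX := isClassX1_of_classX1 hL.classX1
  GeneratorSqueeze.Leaf.bsdp_of_muZero_of_lambdaMem_inter hW16 hGr h310 hmod hGZK hL hμ0 hlam
    (AlgebraicLambdaMem.of_generatorCount_of_muZero_newton hW16 hmod hX.two_ne
      hX.hasGoodReductionAtPrime hX.not_dvd_frobeniusTrace hX.not_hasIrreducibleModPGaloisRep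
      (entireLFunction_one_ne_zero_of_analyticRank_eq_zero hmod W hL.analyticRank_eq_zero) hμ0
      (noFiniteSubmoduleAt_of_prop415ii h415 (lt_of_le_of_ne (Nat.Prime.two_le hp.out)
        (Ne.symm hX.two_ne)) hX.hasGoodReductionAtPrime hX.not_dvd_frobeniusTrace) hB hS) hA'
    fun d ⟨v, hv, hBv, hBd⟩ hd ↦ hgap d v hv hBv hBd hd

/-- **ROUTE M at the `μ = 0` member WITH rational `p`-torsion (`δ = 1`), both weights, from
RATIONAL data**: places `S ∌ p` with `p ∣ c_v(E)`, a rational point of order `p`,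
`v_p(#E(ℚ)_tors) ≤ k`, count `b` with `b + 2k ≤ #S + 2` (FILE 8
`GeneratorCountTorsion.Leaf.generatorCountGE_of_rationalTorsion`), Newton data `S'`, gap check with
`b ≤ v ∧ b ≤ d`. The five census classes `158690a 265370u 330650p 385970k 447356b @3` close this
way at their member `1` (`k = 1`, `#S = 3`, `b = 3`). Named facts as in FILE 8 (`hPT` Poitou–Tate
over `ℚ`, `hGrK` Greenberg Prop. 2.4, Prop. 4.15 (ii), …), all PUBLISHED.
[cite: GreenbergLNM1716, §2 Prop. 2.4, §3 Lemma 3.1/3.4, Prop. 3.10, Thm. 4.1, §5 pp. 114–118, p. 137]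
[cite: Washington1997, §13.2] [cite: Wuthrich2014, Thm. 16 (p. 397)] -/
theorem Leaf.bsdp_of_muZero_of_tamagawaCount_rationalTorsion_lambda
    (hW16 : Wuthrich2014.charIdeal_dvd_padicLFunction) (hGr : greenberg_charValue_rankZero)
    (h310 : prop310_selmerCorank_mod_two_eq_lambdaInvariant)
    (h415 : prop415ii_noFiniteSubmodule_of_ordinary_or_multiplicative)
    (hmod : nonempty_modularParametrizationData)
    (hGZK : rank_eq_analyticRank_of_analyticRank_le_one)
    (hPT : poitouTate_selmerStructure_duality ℚ) (hGrK : imKummer_ge_strictCondition_goodOrdinary)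
    (hL : RankZero.Leaf W p) {k : ℕ} (hk : (W.torsionOrder).factorization p ≤ k)
    (hPt : ∃ P : W.toAffine.Point, P ≠ 0 ∧ p • P = 0)
    (hμ0 : AnalyticMuLE W p 0) {n b : ℕ} {S' : Set (ℕ × ℕ)} (hlam : AnalyticLambdaEq W p n)
    (S : Finset (HeightOneSpectrum (𝓞 ℚ))) (hSp : ∀ v ∈ S, ((p : ℕ) : 𝓞 ℚ) ∉ v.asIdeal)
    (hcv : ∀ v ∈ S,
      p ∣ (W.baseChange (v.adicCompletion ℚ)).localTamagawaNumber (v.adicCompletionIntegers ℚ))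
    (vp : HeightOneSpectrum (𝓞 ℚ)) (hvp : ((p : ℕ) : 𝓞 ℚ) ∈ vp.asIdeal)
    (hb : b + 2 * k ≤ S.card + 2) (hS : AnalyticLamConstValDivisorSet W p S')
    (hgap : ∀ d v, (d, v) ∈ S' → b ≤ v → b ≤ d → Even d → d ≤ n → n ≤ d + 1) : BSDp W p :=
  Leaf.bsdp_of_muZero_of_generatorCount_lambda_of_prop415 hW16 hGr h310 h415 hmod hGZK hL hμ0 hlam
    (GeneratorCountTorsion.Leaf.generatorCountGE_of_rationalTorsion hPT hGrK hL hk hPt S hSp hcv vp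
      hvp hb) hS hgap

/-- **ROUTE M at a `μ = 0` member WITHOUT rational `p`-torsion (`δ = 0`) carrying a certified
`ℚ_p`-point of order `p`, both weights**: places `S ∌ p` with `p ∣ c_v(E)`, `p ∤ #E(ℚ)_tors` (so
`#E[p^∞]^{Γ_ℚ} ≤ p^0`, FILE 8 `natCard_fixedPoints_le_pow_factorization_torsionOrder`), a point of
order `p` in `E(ℚ_p)` (census certificate `hPt`, kit j156914), count `b ≤ #S + 2` (FILE 7
`GeneratorCountTorsion.Leaf.generatorCountGE_torsion`), Newton data `S'`, gap check with
`b ≤ v ∧ b ≤ d`. The census classes `221390j 296450gj 296450jl @3` close this way at member `1`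
(`#S = 1`, `b = 3`). [cite: GreenbergLNM1716, §2 Prop. 2.4, §3 Lemma 3.4, Prop. 3.10, Thm. 4.1, §5 pp. 114–118, p. 137]
[cite: Washington1997, §13.2] [cite: Wuthrich2014, Thm. 16 (p. 397)] -/
theorem Leaf.bsdp_of_muZero_of_tamagawaCountAtP_two_lambda
    (hW16 : Wuthrich2014.charIdeal_dvd_padicLFunction) (hGr : greenberg_charValue_rankZero)
    (h310 : prop310_selmerCorank_mod_two_eq_lambdaInvariant)
    (h415 : prop415ii_noFiniteSubmodule_of_ordinary_or_multiplicative)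
    (hmod : nonempty_modularParametrizationData)
    (hGZK : rank_eq_analyticRank_of_analyticRank_le_one)
    (hPT : poitouTate_selmerStructure_duality ℚ) (hGrK : imKummer_ge_strictCondition_goodOrdinary)
    (hL : RankZero.Leaf W p) (htors : ¬ p ∣ W.torsionOrder)
    (hμ0 : AnalyticMuLE W p 0) {n b : ℕ} {S' : Set (ℕ × ℕ)} (hlam : AnalyticLambdaEq W p n)
    (S : Finset (HeightOneSpectrum (𝓞 ℚ))) (hSp : ∀ v ∈ S, ((p : ℕ) : 𝓞 ℚ) ∉ v.asIdeal)
    (hcv : ∀ v ∈ S,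
      p ∣ (W.baseChange (v.adicCompletion ℚ)).localTamagawaNumber (v.adicCompletionIntegers ℚ))
    (vp : HeightOneSpectrum (𝓞 ℚ)) (hvp : ((p : ℕ) : 𝓞 ℚ) ∈ vp.asIdeal)
    (hPt : ∃ P : (W.baseChange (vp.adicCompletion ℚ)).toAffine.Point, P ≠ 0 ∧ p • P = 0)
    (hb : b ≤ S.card + 2) (hS : AnalyticLamConstValDivisorSet W p S')
    (hgap : ∀ d v, (d, v) ∈ S' → b ≤ v → b ≤ d → Even d → d ≤ n → n ≤ d + 1) : BSDp W p := by
  have hk : (W.torsionOrder).factorization p = 0 := Nat.factorization_eq_zero_of_not_dvd htors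
  have hBk : Nat.card {a : geomPrimaryTorsion W p // ∀ σ : absoluteGaloisGroup ℚ, σ • a = a} ≤
      p ^ 0 := hk ▸ GeneratorCountTorsion.natCard_fixedPoints_le_pow_factorization_torsionOrder W p
  exact Leaf.bsdp_of_muZero_of_generatorCount_lambda_of_prop415 hW16 hGr h310 h415 hmod hGZK hL hμ0
    hlam (GeneratorCountTorsion.Leaf.generatorCountGE_torsion hPT hGrK hL hBk S hSp hcv vp hvp hPt
      (by omega)) hS hgap

end Leaf

end Summit.BirchSwinnertonDyer.Rank1Residual.X1.GeneratorCountLambda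

end
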